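import Summits.Ventures.CertifiedManyBodySolver.Downfold.BoxesHg1201ESlantCut
import HarnessLib

/-!
# HgBa₂CuO₄₊δ «Hg-1201», object E: «SLANT-CUT» part 2b — the ITEM-LEVEL (target-slot) twins: the state-free corner-objective word UNDER THE CHORD,
# and the under-the-chord halves of the four cruxes (stmt-Ventures-26186 / -26187 @0, 27104 / 27105 @10) with binders verbatim

Venture CertifiedManyBodySolver, cell `pub/hubbard-downfold` (D-0154 (1)(C) COVERAGE, Hg-1201), seat `hubbard-cov-hg1201-unc-2` (g3, `prover-hubbard-cov-hg1201-unc-2-g2-0`);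
namespace `Summit.Ventures.CertifiedManyBodySolver.Downfold`. Companion of `Downfold/BoxesHg1201ESlantCut.lean` (part 2a: the stiffness-leaf slant slabs) and of
hubbard-cov-hg1201-box-2's `Downfold/BoxesHg1201EKinematicCoverN.lean` §4 / `…CoverTp.lean` §2–§3 (the state-free words below the n-cut `179/200` and on the inner slots
`σ ≥ −53/100`). The cruxes «PatchBottom» / «PatchLeftEdge» of route `CovHg1201M19b` (and the P10 twins of `CovHg1201M19P10`) are statements about the D₄-orbit mean of the
TARGET-SLOT objective `−X₀(σ, U_A)` on torus-limit sector ground states at density `n`; the kinematic discharge depends on `(σ, n)` only (any source, any label), through the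
torus-limit variational inequality `orbitMean_neg_oddMomentTT_lam_zero_ge_kinematic_of_gs` (box-2 g0) fed with a level `ν` and `ν·n/2 + B(σ, ν) ≤ bar`. The chord level of
`halfBathtub_slant_le_of_readings` (part 1, p629801) between the N-KINCUT corner `(−27/50, 179/200)` and the TP-KINCUT corner `(−53/100, 183/200)` therefore gives:

* §1 `hg1201M19b_slantSlot_orbitMean_ge_negBar`: for every slot `σ ∈ [−27/50, −53/100]`, every density `0 ≤ n ≤ 179/200 + 2(σ + 27/50)`, any label / source / torus-limit
  sector ground state: `−0.5166800 ≤ |D₄|⁻¹ Σ_γ Re ω_γ(−X₀(σ, U_A))`; @10 twin `hg1201M19P10_slantSlot_orbitMean_ge_negBar` (`σ ∈ [−49/100, −12/25]`,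
  `n ≤ 43/50 + 2(σ + 49/100)`, bar `0.4767609`).
* §2 the UNDER-THE-CHORD halves of the four cruxes, binders verbatim (`hg1201M19b_patchBottom_slantSlots_kinematic`, `hg1201M19b_patchLeftEdge_slantSlots_kinematic`,
  `hg1201M19P10_patchBottomP10_slantSlots_kinematic`, `hg1201M19P10_patchLeftEdgeP10_slantSlots_kinematic`): PROVED outright, no certificate. Consequence (route side,
  `Theorems/CovHg1201M19bSlantParts.lean`): after the two cuts of record the certificate part of each crux is the TRIANGLE
  `{σ ∈ [−27/50, −53/100], n ∈ [179/200, 183/200], n ≥ 179/200 + 2(σ + 27/50)}` (@10: `{σ ∈ [−49/100, −12/25], n ≥ 43/50 + 2(σ + 49/100)}`) — HALF of the outer strip.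

HONEST FRAMING: one-body (band) kinematics at `T = 0`, kernel-checked rows composed by real arithmetic, and the torus-limit variational inequality (only the particle number of
the state is used); STATE-FREE words — no ground-state certificate enters; nothing about HgBa₂CuO₄₊δ; the items stay OPEN and owed AS TYPED on their triangles; no cut of
record moves; certified stiffness-scale CEILINGS / kinematic majorants on a downfolded screening-grade box = CONTROL / CALIBRATION wording class (xx1; content = below
`0.98 ×` the kinematic MAJORANT, no suppression below free claimed; @10 = screening-grade pressure frame); silent on the presence of superconductivity; not a `T_c`, phase
or pressure sentence; NO item, stub, rung leaf or summit statement is proved by this file.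

References: E. H. Lieb, M. Loss, Duke Math. J. 71 (1993) 337, §8 [LiebLoss1993]; T. Hazra, N. Verma, M. Randeria, PRX 9 (2019) 031049, eqs. (2)–(6)
[HazraVermaRanderia2019]; W. Rudin, *Principles of Mathematical Analysis* (1976) Thm 6.12 [Rudin1976].
-/

noncomputable section

namespace Summit.Ventures.CertifiedManyBodySolver.Downfold

open Set NonemptyInterval Filter Topology Real
open Summit.Ventures.CertifiedManyBodySolver.Observables
open Summit.Ventures.CertifiedManyBodySolver.Certificates
open Literature.MathematicalPhysics.QuantumLattice Literature.MathematicalPhysics.QuantumLattice.ThermodynamicLimit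
open Literature.Probability.LatticeModels
open Matrix Finset HubbardWave0
open scoped BigOperators ComplexOrder

/-! ## §1 The state-free target-slot word UNDER THE CHORD (@0 and @10) -/

/-- **@0 STATE-FREE target-slot word UNDER THE CHORD.** For every slot `σ ∈ [−27/50, −53/100]`, every density `0 ≤ n ≤ 179/200 + 2(σ + 27/50)`, every label `U_A`,
every source Hamiltonian `hubbardTorusTT' L 1 s U_A'` and every torus limit `ω` of unit `(rectN n L, S^z = 0)`-sector ground states:
`−0.5166800 ≤ |D₄|⁻¹ Σ_γ Re ω_γ(−X₀(σ, U_A))` — the chord level `ν(b)` of `halfBathtub_slant_le_of_readings` on the two `M = 512` rows of record, then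
`orbitMean_neg_oddMomentTT_lam_zero_ge_kinematic_of_gs`. [cite: LiebLoss1993, §8, Theorem 8.2] [cite: HazraVermaRanderia2019, eqs. (2)-(6)] [cite: Rudin1976, Thm 6.12] -/
theorem hg1201M19b_slantSlot_orbitMean_ge_negBar (σ UA s UA' : ℝ) (hσ : σ ∈ Icc (-27 / 50 : ℝ) (-53 / 100))
    {n : ℝ} (hn0 : 0 ≤ n) (hn : n ≤ 179 / 200 + 2 * (σ + 27 / 50))
    (ω : InfVolFermionState 2) (Ls : ℕ → ℕ) (ψ : ∀ L, Fock (Orb (FermionTorus 2 L)))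
    (hLs : Tendsto Ls atTop atTop)
    (hψ : ∀ j, IsGroundStateInSector (hubbardTorusTT' (Ls j) 1 s UA') (rectN n (Ls j)) 0 (ψ (Ls j)))
    (h1 : ∀ j, star (ψ (Ls j)) ⬝ᵥ ψ (Ls j) = 1) (hω : ω.IsTorusLimitOf ψ Ls) :
    -(5166800 / 10000000 : ℝ) ≤ ((Finset.univ : Finset (DihedralGroup 4)).card : ℝ)⁻¹ * ∑ γ ∈ (Finset.univ : Finset (DihedralGroup 4)),
        (ω.expect (d4ShiftSet γ 0 (box 2 7)) (fermionEmbed (PolySite.d4Emb γ 0 (box 2 7)) (-oddMomentObsTT σ UA 0))).re := by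
  obtain ⟨h₁, h₂⟩ := hg1201M19b_slantCorner_readings
  obtain ⟨hr₁, hr₂, hD⟩ := hg1201M19b_slant_sideTrio
  have hn' : n ≤ 179 / 200 + (183 / 200 - 179 / 200) * ((σ - -27 / 50) / (-53 / 100 - -27 / 50)) := by
    have e : (183 / 200 - 179 / 200 : ℝ) * ((σ - -27 / 50) / (-53 / 100 - -27 / 50)) = 2 * (σ + 27 / 50) := by ring
    rw [e]; exact hn
  obtain ⟨ν, -, hν⟩ := halfBathtub_slant_le_of_readings (t₁ := -27 / 50) (t₂ := -53 / 100) (ν₁ := 3863 / 8192) (ν₂ := 3823 / 8192)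
    (n₁ := 179 / 200) (n₂ := 183 / 200) (by norm_num) (by norm_num) (by norm_num) h₁ h₂ hr₁ hr₂ hD hσ hn'
  have hkin := orbitMean_neg_oddMomentTT_lam_zero_ge_kinematic_of_gs σ UA s UA' (ν := ν) le_rfl hn0
    (by linarith [hσ.2]) ω Ls ψ hLs hψ h1 hω
  have hc : (((5166800 / 10000000 : ℚ)) : ℝ) = 5166800 / 10000000 := by norm_num
  rw [hc] at hν
  linarith

/-- **@10 STATE-FREE target-slot word UNDER THE CHORD**: `σ ∈ [−49/100, −12/25]`, `0 ≤ n ≤ 43/50 + 2(σ + 49/100)`, any label / source / torus-limit sector ground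
state: `−0.4767609 ≤ |D₄|⁻¹ Σ_γ Re ω_γ(−X₀(σ, U_A))` (rows `B(−49/100, 4301/8192) ≤ 0.2502620098`, `B(−12/25, 4273/8192) ≤ 0.2456919725`).
[cite: LiebLoss1993, §8, Theorem 8.2] [cite: HazraVermaRanderia2019, eqs. (2)-(6)] [cite: Rudin1976, Thm 6.12] -/
theorem hg1201M19P10_slantSlot_orbitMean_ge_negBar (σ UA s UA' : ℝ) (hσ : σ ∈ Icc (-49 / 100 : ℝ) (-12 / 25))
    {n : ℝ} (hn0 : 0 ≤ n) (hn : n ≤ 43 / 50 + 2 * (σ + 49 / 100))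
    (ω : InfVolFermionState 2) (Ls : ℕ → ℕ) (ψ : ∀ L, Fock (Orb (FermionTorus 2 L)))
    (hLs : Tendsto Ls atTop atTop)
    (hψ : ∀ j, IsGroundStateInSector (hubbardTorusTT' (Ls j) 1 s UA') (rectN n (Ls j)) 0 (ψ (Ls j)))
    (h1 : ∀ j, star (ψ (Ls j)) ⬝ᵥ ψ (Ls j) = 1) (hω : ω.IsTorusLimitOf ψ Ls) :
    -(4767609 / 10000000 : ℝ) ≤ ((Finset.univ : Finset (DihedralGroup 4)).card : ℝ)⁻¹ * ∑ γ ∈ (Finset.univ : Finset (DihedralGroup 4)),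
        (ω.expect (d4ShiftSet γ 0 (box 2 7)) (fermionEmbed (PolySite.d4Emb γ 0 (box 2 7)) (-oddMomentObsTT σ UA 0))).re := by
  obtain ⟨h₁, h₂⟩ := hg1201M19P10_slantCorner_readings
  obtain ⟨hr₁, hr₂, hD⟩ := hg1201M19P10_slant_sideTrio
  have hn' : n ≤ 43 / 50 + (22 / 25 - 43 / 50) * ((σ - -49 / 100) / (-12 / 25 - -49 / 100)) := by
    have e : (22 / 25 - 43 / 50 : ℝ) * ((σ - -49 / 100) / (-12 / 25 - -49 / 100)) = 2 * (σ + 49 / 100) := by ring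
    rw [e]; exact hn
  obtain ⟨ν, -, hν⟩ := halfBathtub_slant_le_of_readings (t₁ := -49 / 100) (t₂ := -12 / 25) (ν₁ := 4301 / 8192) (ν₂ := 4273 / 8192)
    (n₁ := 43 / 50) (n₂ := 22 / 25) (by norm_num) (by norm_num) (by norm_num) h₁ h₂ hr₁ hr₂ hD hσ hn'
  have hkin := orbitMean_neg_oddMomentTT_lam_zero_ge_kinematic_of_gs σ UA s UA' (ν := ν) le_rfl hn0
    (by linarith [hσ.2]) ω Ls ψ hLs hψ h1 hω
  have hc : (((4767609 / 10000000 : ℚ)) : ℝ) = 4767609 / 10000000 := by norm_num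
  rw [hc] at hν
  linarith

/-! ## §2 The UNDER-THE-CHORD halves of the four cruxes (binders verbatim; PROVED outright) -/

/-- **The under-the-chord half of «PatchBottom» (stmt-Ventures-26187)** — slots `σ ∈ [−27/50, −53/100]`, densities `n ≤ 179/200 + 2(σ + 27/50)`, sources
`s ∈ [−27/50, σ]`, `U = 7/2`, objective `−X₀(σ, 7/2)`: holds state-free. The certificate part of the outer strip is the TRIANGLE above the chord.
[cite: LiebLoss1993, §8, Theorem 8.2] [cite: HazraVermaRanderia2019, eqs. (2)-(6)] -/
theorem hg1201M19b_patchBottom_slantSlots_kinematic :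
    ∀ n ∈ Set.Icc (87 / 100 : ℝ) (183 / 200), ∀ σ ∈ Set.Icc (-27 / 50 : ℝ) (-53 / 100), n ≤ 179 / 200 + 2 * (σ + 27 / 50) →
      ∀ s ∈ Set.Icc (-27 / 50 : ℝ) σ,
      ∀ (ω : InfVolFermionState 2) (Ls : ℕ → ℕ) (ψ : ∀ L, Fock (Orb (FermionTorus 2 L))),
      Tendsto Ls atTop atTop →
      (∀ j, IsGroundStateInSector (hubbardTorusTT' (Ls j) 1 s (7 / 2)) (rectN n (Ls j)) 0 (ψ (Ls j))) →
      (∀ j, star (ψ (Ls j)) ⬝ᵥ ψ (Ls j) = 1) → ω.IsTorusLimitOf ψ Ls →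
      -(5166800 / 10000000 : ℝ) ≤ ((Finset.univ : Finset (DihedralGroup 4)).card : ℝ)⁻¹ * ∑ g ∈ (Finset.univ : Finset (DihedralGroup 4)),
        (ω.expect (d4ShiftSet g 0 (Literature.Probability.LatticeModels.box 2 7))
          (fermionEmbed (PolySite.d4Emb g 0 (Literature.Probability.LatticeModels.box 2 7)) (-oddMomentObsTT σ (7 / 2) 0))).re :=
  fun _ hn σ hσ hcut s _ ω Ls ψ hLs hψ h1 hω =>
    hg1201M19b_slantSlot_orbitMean_ge_negBar σ (7 / 2) s (7 / 2) hσ (by linarith [hn.1]) hcut ω Ls ψ hLs hψ h1 hω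

/-- **The under-the-chord half of «PatchLeftEdge» (stmt-Ventures-26186)** — states at `(−27/50, U′, n)`, `U′ ∈ [7/2, 44/5]`, objective `−X₀(σ, U′)`,
`σ ∈ [−27/50, −53/100]`, `n ≤ 179/200 + 2(σ + 27/50)`: holds state-free. [cite: LiebLoss1993, §8, Theorem 8.2] [cite: HazraVermaRanderia2019, eqs. (2)-(6)] -/
theorem hg1201M19b_patchLeftEdge_slantSlots_kinematic :
    ∀ n ∈ Set.Icc (87 / 100 : ℝ) (183 / 200), ∀ σ ∈ Set.Icc (-27 / 50 : ℝ) (-53 / 100), n ≤ 179 / 200 + 2 * (σ + 27 / 50) →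
      ∀ U' ∈ Set.Icc (7 / 2 : ℝ) (44 / 5),
      ∀ (ω : InfVolFermionState 2) (Ls : ℕ → ℕ) (ψ : ∀ L, Fock (Orb (FermionTorus 2 L))),
      Tendsto Ls atTop atTop →
      (∀ j, IsGroundStateInSector (hubbardTorusTT' (Ls j) 1 (-27 / 50) U') (rectN n (Ls j)) 0 (ψ (Ls j))) →
      (∀ j, star (ψ (Ls j)) ⬝ᵥ ψ (Ls j) = 1) → ω.IsTorusLimitOf ψ Ls →
      -(5166800 / 10000000 : ℝ) ≤ ((Finset.univ : Finset (DihedralGroup 4)).card : ℝ)⁻¹ * ∑ g ∈ (Finset.univ : Finset (DihedralGroup 4)),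
        (ω.expect (d4ShiftSet g 0 (Literature.Probability.LatticeModels.box 2 7))
          (fermionEmbed (PolySite.d4Emb g 0 (Literature.Probability.LatticeModels.box 2 7)) (-oddMomentObsTT σ U' 0))).re :=
  fun _ hn σ hσ hcut U' _ ω Ls ψ hLs hψ h1 hω =>
    hg1201M19b_slantSlot_orbitMean_ge_negBar σ U' (-27 / 50) U' hσ (by linarith [hn.1]) hcut ω Ls ψ hLs hψ h1 hω

/-- **The under-the-chord half of «PatchBottomP10» (stmt-Ventures-27105)** — slots `σ ∈ [−49/100, −12/25]`, densities `n ≤ 43/50 + 2(σ + 49/100)`, sources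
`s ∈ [−49/100, σ]`, `U = 3`: holds state-free. [cite: LiebLoss1993, §8, Theorem 8.2] [cite: HazraVermaRanderia2019, eqs. (2)-(6)] -/
theorem hg1201M19P10_patchBottomP10_slantSlots_kinematic :
    ∀ n ∈ Set.Icc (21 / 25 : ℝ) (22 / 25), ∀ σ ∈ Set.Icc (-49 / 100 : ℝ) (-12 / 25), n ≤ 43 / 50 + 2 * (σ + 49 / 100) →
      ∀ s ∈ Set.Icc (-49 / 100 : ℝ) σ,
      ∀ (ω : InfVolFermionState 2) (Ls : ℕ → ℕ) (ψ : ∀ L, Fock (Orb (FermionTorus 2 L))),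
      Tendsto Ls atTop atTop →
      (∀ j, IsGroundStateInSector (hubbardTorusTT' (Ls j) 1 s 3) (rectN n (Ls j)) 0 (ψ (Ls j))) →
      (∀ j, star (ψ (Ls j)) ⬝ᵥ ψ (Ls j) = 1) → ω.IsTorusLimitOf ψ Ls →
      -(4767609 / 10000000 : ℝ) ≤ ((Finset.univ : Finset (DihedralGroup 4)).card : ℝ)⁻¹ * ∑ g ∈ (Finset.univ : Finset (DihedralGroup 4)),
        (ω.expect (d4ShiftSet g 0 (Literature.Probability.LatticeModels.box 2 7))
          (fermionEmbed (PolySite.d4Emb g 0 (Literature.Probability.LatticeModels.box 2 7)) (-oddMomentObsTT σ 3 0))).re :=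
  fun _ hn σ hσ hcut s _ ω Ls ψ hLs hψ h1 hω =>
    hg1201M19P10_slantSlot_orbitMean_ge_negBar σ 3 s 3 hσ (by linarith [hn.1]) hcut ω Ls ψ hLs hψ h1 hω

/-- **The under-the-chord half of «PatchLeftEdgeP10» (stmt-Ventures-27104)** — states at `(−49/100, U′, n)`, `U′ ∈ [3, 17/2]`, `σ ∈ [−49/100, −12/25]`,
`n ≤ 43/50 + 2(σ + 49/100)`: holds state-free. [cite: LiebLoss1993, §8, Theorem 8.2] [cite: HazraVermaRanderia2019, eqs. (2)-(6)] -/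
theorem hg1201M19P10_patchLeftEdgeP10_slantSlots_kinematic :
    ∀ n ∈ Set.Icc (21 / 25 : ℝ) (22 / 25), ∀ σ ∈ Set.Icc (-49 / 100 : ℝ) (-12 / 25), n ≤ 43 / 50 + 2 * (σ + 49 / 100) →
      ∀ U' ∈ Set.Icc (3 : ℝ) (17 / 2),
      ∀ (ω : InfVolFermionState 2) (Ls : ℕ → ℕ) (ψ : ∀ L, Fock (Orb (FermionTorus 2 L))),
      Tendsto Ls atTop atTop →
      (∀ j, IsGroundStateInSector (hubbardTorusTT' (Ls j) 1 (-49 / 100) U') (rectN n (Ls j)) 0 (ψ (Ls j))) →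
      (∀ j, star (ψ (Ls j)) ⬝ᵥ ψ (Ls j) = 1) → ω.IsTorusLimitOf ψ Ls →
      -(4767609 / 10000000 : ℝ) ≤ ((Finset.univ : Finset (DihedralGroup 4)).card : ℝ)⁻¹ * ∑ g ∈ (Finset.univ : Finset (DihedralGroup 4)),
        (ω.expect (d4ShiftSet g 0 (Literature.Probability.LatticeModels.box 2 7))
          (fermionEmbed (PolySite.d4Emb g 0 (Literature.Probability.LatticeModels.box 2 7)) (-oddMomentObsTT σ U' 0))).re :=
  fun _ hn σ hσ hcut U' _ ω Ls ψ hLs hψ h1 hω =>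
    hg1201M19P10_slantSlot_orbitMean_ge_negBar σ U' (-49 / 100) U' hσ (by linarith [hn.1]) hcut ω Ls ψ hLs hψ h1 hω

/-- Literals (decidable): on the @0 outer strip `σ ∈ [−27/50, −53/100]` the chord density runs from `179/200` (= n_k, at `σ = −27/50`) to `183/200` (the top, at
`σ = −53/100`); on the @10 outer strip `σ ∈ [−49/100, −12/25]` from `43/50` (= n_k′) to `22/25`; the triangle above each chord is HALF of its strip in the `(σ, n)` face
(`(1/2)(1/100)(1/50) / ((1/100)(1/50)) = 1/2`). [folklore] -/
theorem hg1201E_slantSlots_literals :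
    ((179 / 200 : ℚ) + 2 * (-27 / 50 + 27 / 50) = 179 / 200) ∧ ((179 / 200 : ℚ) + 2 * (-53 / 100 + 27 / 50) = 183 / 200) ∧
    ((43 / 50 : ℚ) + 2 * (-49 / 100 + 49 / 100) = 43 / 50) ∧ ((43 / 50 : ℚ) + 2 * (-12 / 25 + 49 / 100) = 22 / 25) ∧
    ((1 / 2 : ℚ) * (1 / 100) * (1 / 50) / ((1 / 100) * (1 / 50)) = 1 / 2) := by
  norm_num

end Summit.Ventures.CertifiedManyBodySolver.Downfold

end
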